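import Mathlib
import Summits.ValiantsHypothesis.ValiantsHypothesis.Theorems.NewtonUnitEquationsNewtonTauWeakHexagonClasses

/-!
# `NewtonUnitEquationsNewtonTauWeakHexagonOnePlusSep` — one hexagon product plus separated products

Rung toward `stub_binomialNewtonTauCommon` (T2 = KPTT Conj. 1 at `t = 2`; crux `NewtonTauWeak`,
stmt-ValiantsHypothesis-5904), line `binomial-normal-form`, lead c4 (K-UNIFORM three-ray regime): registered stub
`stub_hexOnePlusSep`.

`stub_hexOnePlusSep`: for x-only `X`, y-only `Y`, diagonal `D` and `r` separated products `A_i·B_i` (`A_i`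
x-only, `B_i` y-only), `vert(X·Y·D + Σ_i A_i·B_i) ≤ 4 + 4·2·(2+1)·(8 + 8·(2!·2^{2·2}·(r+1)^2))`.  This is the
class theorem `stub_hexClasses` (`…HexagonClasses`) with `k = r + 1` products and `q = 2` diagonal classes:
class `0` is the hexagon product (diagonal factor `D`), class `1` collects the separated products (diagonal
factor `1`, whose support `{0}` lies on the diagonal). [folklore: Wronskian method]
-/

set_option linter.dupNamespace false

noncomputable section

namespace Summit.ValiantsHypothesis.ValiantsHypothesis.Theorems.NewtonUnitEquationsNewtonTauWeak

open scoped BigOperators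
open MvPolynomial
open Summit.ValiantsHypothesis.ValiantsHypothesis.Theorems.NewtonTauWeak.Negative (vert)

/-- **One hexagon product plus `r` separated products.** For x-only `X`, y-only `Y`, diagonal `D`, x-only
`A_i` and y-only `B_i` (`i < r`), `vert(X·Y·D + Σ_i A_i·B_i) ≤ 4 + 4·2·(2+1)·(8 + 8·(2!·2^{2·2}·(r+1)^2))`:
the class theorem `stub_hexClasses` at `k = r + 1`, `q = 2`, with the families `vecCons X A`, `vecCons Y B`,
the class map `vecCons 0 (fun _ => 1)` and the diagonal factors `![D, 1]` (the constant `1` is diagonal).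
[folklore: Wronskian method] -/
theorem stub_hexOnePlusSep (r : ℕ) (X Y D : MvPolynomial (Fin 2) ℂ) (A B : Fin r → MvPolynomial (Fin 2) ℂ)
    (hX : ∀ e ∈ X.support, e 1 = 0) (hY : ∀ e ∈ Y.support, e 0 = 0) (hD : ∀ e ∈ D.support, e 0 = e 1)
    (hA : ∀ i, ∀ e ∈ (A i).support, e 1 = 0) (hB : ∀ i, ∀ e ∈ (B i).support, e 0 = 0) :
    vert (X * Y * D + ∑ i, A i * B i) ≤
      4 + 4 * 2 * (2 + 1) * (8 + 8 * (Nat.factorial 2 * 2 ^ (2 * 2) * (r + 1) ^ 2)) := by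
  -- the `Fin (r + 1)`-indexed families: index `0` is the hexagon product, `Fin.succ i` the separated product `i`
  set X' : Fin (r + 1) → MvPolynomial (Fin 2) ℂ := Matrix.vecCons X A with hX'
  set Y' : Fin (r + 1) → MvPolynomial (Fin 2) ℂ := Matrix.vecCons Y B with hY'
  set cls : Fin (r + 1) → Fin 2 := Matrix.vecCons 0 fun _ => 1 with hcls
  set D' : Fin 2 → MvPolynomial (Fin 2) ℂ := ![D, 1] with hD'
  have hsum : X * Y * D + ∑ i, A i * B i = ∑ i, X' i * Y' i * D' (cls i) := by
    rw [Fin.sum_univ_succ]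
    simp [hX', hY', hcls, hD']
  rw [hsum]
  refine stub_hexClasses (r + 1) 2 cls X' Y' D' ?_ ?_ ?_
  · refine Fin.forall_fin_succ.2 ⟨?_, fun i => ?_⟩
    · simpa [hX'] using hX
    · simpa [hX'] using hA i
  · refine Fin.forall_fin_succ.2 ⟨?_, fun i => ?_⟩
    · simpa [hY'] using hY
    · simpa [hY'] using hB i
  · -- class `0`: the diagonal factor `D`; class `1`: the constant `1`, whose support `{0}` is diagonal
    refine Fin.forall_fin_two.2 ⟨?_, ?_⟩
    · simpa [hD'] using hD
    · simp [hD']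

end Summit.ValiantsHypothesis.ValiantsHypothesis.Theorems.NewtonUnitEquationsNewtonTauWeak

end
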